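import Summits.CriticalPhenomena.PercolationContinuityZ3.Theorems.PercNearOneGluingNoHeavyLowerTailSahiCombTriWAndClawPlus
import Summits.CriticalPhenomena.PercolationContinuityZ3.Theorems.PercNearOneGluingNoHeavyLowerTailSahiCombTriWAndClawRealize

/-!
# AND with a claw with ANY NUMBER `a ≥ 3` of doubled prongs: `clawMatching E = claw k ∪ {⊤ ∖ d : d ∈ E}`, `E` a partial matching of `Fin k`

Support file of the one-cut programme (crux `NoHeavyLowerTail`, stmt-CriticalPhenomena-4575; unit `prim-lf-1` gen 49), continuation of
`…SahiCombTriWAndClaw` (main lemma with the slack `Σ cc'`), `…AndClawPlus` (the extra columns `clawV`), `…AndClawRealize` (the claw theorem in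
abstract form).  For a set `E` of pairwise disjoint 2-subsets of `Fin k` ("partial matching", `#E = a`) the block `clawMatching E` is the claw on the
`k − a` blocks `{d ∈ E} ∪ {singletons}` with the `a` matched prongs DOUBLED: `claw_{k-a} ∘ (x_p x_q for {p,q} ∈ E, x_r otherwise)` = the up-set
generated by the pairwise co-covering sets `⊤∖d (d ∈ E)`, `⊤∖{r} (r unmatched)` (memo `FROM-prim-lf-1-gen49-CLAW.md` §3: the profiles `Q(2^a,1^m)`).
* `clawMatching`, `mem_clawMatching`, `sum_clawMatching`, `isUpperSet_clawMatching`, `disjoint_clawMatching_refl` (`k ≥ 5`); the extra columns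
  `clawVd A d x = [x ⊔ (⊤∖d) ∈ A] − [xᶜ ⊔ d ∈ A]` (`= clawV A p q` for `d = {p,q}`) and their K-facts; `corP_andProd_clawMatching_eq`.
* **`corP_andProd_clawMatching_nonneg`** (`#E ≥ 3`, `k ≥ 4`): `Cor_{P₁ ∧ clawMatching E}(A,B) ≥ 0` for every antipode-free up-set `P₁` with `Cor_{P₁} ≥ 0` and
  all up-sets `A, B`.  PROOF: `Cor = Σ_x Σ_{d∈E} v_d v_d' + Cor_{P₁∧claw k} ≥ Σ_x [cc' + Σ_d v_d v_d']` (claw main lemma, `c = s_{k-2}`), and the tuple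
  `(c; (v_d)_{d∈E})` is an ABSTRACT CLAW (`c` unit K, `v_d ≤ c`, pair conditions `(c,v_d)`, `(v_d,v_{d'})`), so `sum_clawTuple_nonneg'` (`a ≥ 3`) ends it.
  (`a = 1, 2` are `…AndClawPlus`, `…AndClawPlusTwo*`: there the tuple is the BAD claw_1 / claw_2 and extra slack is needed.)
* `triW_nonneg_andProd_clawMatching`, `klShell_andProd_clawMatching`, `lForm_le_scoreVal_andProd_clawMatching` (`k ≥ 5`).
With the earlier files: the AND-substituted-claw conjecture holds for EVERY profile whose blocks have size ≤ 2.
HONEST LABEL: complete proofs, std axioms; profiles with a block of size ≥ 3 stay OPEN. [this work]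
-/

namespace Summit.CriticalPhenomena.PercolationContinuityZ3.Theorems

namespace FiveUpSet

open Finset

variable {γ₁ : Type} [DecidableEq γ₁] [Fintype γ₁] {k : ℕ}

/-! ### The family -/

/-- `clawMatching E = claw k ∪ {univ ∖ d : d ∈ E}`. [this work] -/
def clawMatching (E : Finset (Finset (Fin k))) : Finset (Finset (Fin k)) := claw k ∪ E.image fun d => univ \ d

/-- Membership in `clawMatching E`. [this work] -/
theorem mem_clawMatching {E : Finset (Finset (Fin k))} {y : Finset (Fin k)} : y ∈ clawMatching E ↔ k ≤ y.card + 1 ∨ ∃ d ∈ E, univ \ d = y := by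
  unfold clawMatching; rw [mem_union, mem_claw, mem_image]

/-- Cardinality of `univ ∖ d`. [this work] -/
theorem card_univ_sdiff (d : Finset (Fin k)) : (univ \ d).card = k - d.card := by
  rw [card_sdiff_of_subset (subset_univ d), card_univ, Fintype.card_fin]

/-- The claw and the extra elements are disjoint (as families). [this work] -/
theorem disjoint_claw_image {E : Finset (Finset (Fin k))} (h2 : ∀ d ∈ E, d.card = 2) : Disjoint (claw k) (E.image fun d => univ \ d) := by
  rw [disjoint_left]
  intro y hy hy'
  rw [mem_claw] at hy
  rw [mem_image] at hy'
  obtain ⟨d, hdE, rfl⟩ := hy'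
  rw [card_univ_sdiff, h2 d hdE] at hy
  have : 2 ≤ k := by have := card_le_univ d; rw [Fintype.card_fin, h2 d hdE] at this; exact this
  omega

/-- Summing over `clawMatching E`. [this work] -/
theorem sum_clawMatching {E : Finset (Finset (Fin k))} (h2 : ∀ d ∈ E, d.card = 2) (f : Finset (Fin k) → ℤ) :
    ∑ y ∈ clawMatching E, f y = ∑ y ∈ claw k, f y + ∑ d ∈ E, f (univ \ d) := by
  unfold clawMatching
  rw [sum_union (disjoint_claw_image h2), sum_image]
  intro d _ d' _ h
  have e1 : univ \ (univ \ d) = d := Finset.sdiff_sdiff_eq_self (subset_univ d)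
  have e2 : univ \ (univ \ d') = d' := Finset.sdiff_sdiff_eq_self (subset_univ d')
  rw [← e1, ← e2]
  exact congrArg (fun s => univ \ s) h

/-- `clawMatching E` is an up-set. [this work] -/
theorem isUpperSet_clawMatching {E : Finset (Finset (Fin k))} (h2 : ∀ d ∈ E, d.card = 2) : IsUpperSet (clawMatching E : Set (Finset (Fin k))) := by
  intro y y' hyy' hy
  rw [mem_coe, mem_clawMatching] at hy ⊢
  rcases hy with hy | ⟨d, hdE, rfl⟩
  · exact Or.inl (hy.trans (by have := card_le_card hyy'; omega))
  · by_cases he : y' = univ \ d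
    · exact Or.inr ⟨d, hdE, he.symm⟩
    · left
      have hlt : (univ \ d).card < y'.card := card_lt_card (lt_of_le_of_ne hyy' (fun h' => he h'.symm))
      rw [card_univ_sdiff, h2 d hdE] at hlt
      omega

/-- `clawMatching E` is antipode free for `k ≥ 5`. [this work] -/
theorem disjoint_clawMatching_refl (hk : 5 ≤ k) {E : Finset (Finset (Fin k))} (h2 : ∀ d ∈ E, d.card = 2) :
    Disjoint (clawMatching E) (refl (clawMatching E)) := by
  rw [disjoint_left]
  intro y hy hy'
  rw [mem_refl, mem_clawMatching] at hy'
  rw [mem_clawMatching] at hy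
  have hc := card_compl y
  rw [Fintype.card_fin] at hc
  have hcy := card_le_univ y
  rw [Fintype.card_fin] at hcy
  have size : ∀ z : Finset (Fin k), (k ≤ z.card + 1 ∨ ∃ d ∈ E, univ \ d = z) → k ≤ z.card + 2 := by
    rintro z (hz | ⟨d, hdE, rfl⟩)
    · omega
    · rw [card_univ_sdiff, h2 d hdE]; omega
  have h1 := size y hy
  have h2' := size yᶜ hy'
  omega

/-! ### The extra columns -/

/-- Extra column of `d`: `v_d(x) = [x ⊔ (⊤∖d) ∈ A] − [xᶜ ⊔ d ∈ A]`. [this work] -/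
def clawVd (A : Finset (Finset (γ₁ ⊕ Fin k))) (d : Finset (Fin k)) (x : Finset γ₁) : ℤ := sgnDiff A (refl A) (x.disjSum (univ \ d))

/-- For a pair `d = {p,q}` the extra column is `clawV A p q`. [this work] -/
theorem clawVd_pair (A : Finset (Finset (γ₁ ⊕ Fin k))) (p q : Fin k) (x : Finset γ₁) : clawVd A {p, q} x = clawV A p q x := by
  unfold clawVd clawV
  congr 2
  ext i; simp only [mem_sdiff, mem_univ, true_and, mem_insert, mem_singleton, mem_erase]; tauto

/-- Values of the extra column lie in `[-1,1]`. [this work] -/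
theorem clawVd_bounds (A : Finset (Finset (γ₁ ⊕ Fin k))) (d : Finset (Fin k)) (x : Finset γ₁) : -1 ≤ clawVd A d x ∧ clawVd A d x ≤ 1 := by
  unfold clawVd sgnDiff; split_ifs <;> simp

section vdfacts
variable {A : Finset (Finset (γ₁ ⊕ Fin k))} (hA : IsUpperSet (A : Set (Finset (γ₁ ⊕ Fin k))))
include hA

/-- The extra column is increasing. [this work] -/
theorem clawVd_mono (d : Finset (Fin k)) {x x' : Finset γ₁} (h : x ⊆ x') : clawVd A d x ≤ clawVd A d x' := by
  unfold clawVd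
  rw [sgnDiff_refl_eq, sgnDiff_refl_eq, compl_disjSum, compl_disjSum]
  have h1 := ind_mono_pt hA (disjSum_mono h (le_refl (univ \ d)))
  have h2 := ind_mono_pt hA (disjSum_mono (compl_subset_compl.2 h) (le_refl (univ \ d)ᶜ))
  linarith

/-- A pair column lies below the second-largest sorted co-atom column. [this work] -/
theorem clawVd_le_clawS {d : Finset (Fin k)} (hd : d.card = 2) (x : Finset γ₁) (jc : Fin k) (hjc : (jc : ℕ) = k - 2) :
    clawVd A d x ≤ clawS A x jc := by
  obtain ⟨p, q, hpq, rfl⟩ := card_eq_two.1 hd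
  rw [clawVd_pair]; exact clawV_le_clawS hA hpq x jc hjc

/-- Pair condition of a pair column against the sorted columns of index `≥ 2`. [this work] -/
theorem clawVd_add_clawS_nonneg {d : Finset (Fin k)} (hd : d.card = 2) {x x' : Finset γ₁} (h : x ∪ x' = univ) (j : Fin k) (hj : 2 ≤ (j : ℕ)) :
    0 ≤ clawVd A d x + clawS A x' j := by
  obtain ⟨p, q, _, rfl⟩ := card_eq_two.1 hd
  rw [clawVd_pair]; exact clawV_add_clawS_nonneg hA h j hj

/-- Cross pair condition of two DISJOINT pair columns. [this work] -/
theorem clawVd_add_clawVd_nonneg {d d' : Finset (Fin k)} (hd : d.card = 2) (hd' : d'.card = 2) (hdd : Disjoint d d') {x x' : Finset γ₁}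
    (h : x ∪ x' = univ) : 0 ≤ clawVd A d x + clawVd A d' x' := by
  obtain ⟨p, q, _, rfl⟩ := card_eq_two.1 hd
  obtain ⟨p', q', _, rfl⟩ := card_eq_two.1 hd'
  rw [clawVd_pair, clawVd_pair]
  rw [disjoint_left] at hdd
  have hp : p ∈ ({p, q} : Finset (Fin k)) := by simp
  have hq : q ∈ ({p, q} : Finset (Fin k)) := by simp
  refine clawV_add_clawV_nonneg hA (fun e => hdd hp (by rw [e]; simp)) (fun e => hdd hp (by rw [e]; simp))
    (fun e => hdd hq (by rw [e]; simp)) (fun e => hdd hq (by rw [e]; simp)) h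

end vdfacts

/-! ### The row decomposition and the theorem -/

/-- **Row decomposition**: `Cor_{P₁ ∧ clawMatching E}(A,B) = Σ_{x∈P₁} Σ_{d∈E} v_d v_d' + Cor_{P₁ ∧ claw k}(A,B)`. [this work] -/
theorem corP_andProd_clawMatching_eq {E : Finset (Finset (Fin k))} (h2 : ∀ d ∈ E, d.card = 2) (P₁ : Finset (Finset γ₁))
    (A B : Finset (Finset (γ₁ ⊕ Fin k))) :
    corP (andProd P₁ (clawMatching E)) A B = (∑ x ∈ P₁, ∑ d ∈ E, clawVd A d x * clawVd B d x) + corP (andProd P₁ (claw k)) A B := by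
  rw [corP_eq_sum, corP_eq_sum, andProd_eq_biUnion, sum_biUnion (pairwiseDisjoint_rows P₁ _), andProd_eq_biUnion,
    sum_biUnion (pairwiseDisjoint_rows P₁ _), ← sum_add_distrib]
  refine sum_congr rfl fun x _ => ?_
  rw [sum_map, sum_map, sum_clawMatching h2, add_comm]
  unfold clawVd
  simp only [rowEmb_apply]

section mainthm
variable {P₁ : Finset (Finset γ₁)} (hP : IsUpperSet (P₁ : Set (Finset γ₁))) (hd : Disjoint P₁ (refl P₁))
  (hcor : ∀ U V : Finset (Finset γ₁), IsUpperSet (U : Set (Finset γ₁)) → IsUpperSet (V : Set (Finset γ₁)) → 0 ≤ corP P₁ U V)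
  {A B : Finset (Finset (γ₁ ⊕ Fin k))} (hA : IsUpperSet (A : Set (Finset (γ₁ ⊕ Fin k)))) (hB : IsUpperSet (B : Set (Finset (γ₁ ⊕ Fin k))))
  {E : Finset (Finset (Fin k))} (h2 : ∀ d ∈ E, d.card = 2) (hdis : ∀ d ∈ E, ∀ d' ∈ E, d ≠ d' → Disjoint d d')

include hP hd hcor hA hB h2 hdis in
/-- **THEOREM (AND with a claw with `a ≥ 3` doubled prongs).**  For a partial matching `E` of `Fin k` with `#E ≥ 3` and `k ≥ 4`, and every antipode-free
up-set `P₁` with `Cor_{P₁} ≥ 0` on up-set pairs: `Cor_{P₁ ∧ clawMatching E}(A,B) ≥ 0` for all up-sets `A, B`. [this work] -/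
theorem corP_andProd_clawMatching_nonneg (hk : 4 ≤ k) (hE : 3 ≤ E.card) : 0 ≤ corP (andProd P₁ (clawMatching E)) A B := by
  obtain ⟨jc, hjc⟩ : ∃ j : Fin k, (j : ℕ) = k - 2 := ⟨⟨k - 2, by omega⟩, rfl⟩
  have hjc1 : 1 ≤ (jc : ℕ) := by omega
  have hjc2 : 2 ≤ (jc : ℕ) := by omega
  rw [corP_andProd_clawMatching_eq h2]
  have hmain := sum_clawS_sq_le_corP_andProd_claw hP hd hcor hA hB hk jc hjc
  have hι : 3 ≤ Fintype.card ↥E := by rw [Fintype.card_coe]; exact hE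
  have key := sum_clawTuple_nonneg' (ι := ↥E) hι hP hd hcor (fun x => clawS A x jc) (fun x => clawS B x jc)
    (fun d x => clawVd A d.1 x) (fun d x => clawVd B d.1 x)
    (fun x _ => clawS_val A x jc) (fun d x _ => by have := clawVd_bounds A d.1 x; omega)
    (fun x _ x' _ h => clawS_mono hA h jc) (fun d x _ x' _ h => clawVd_mono hA d.1 h)
    (fun d x _ => clawVd_le_clawS hA (h2 d.1 d.2) x jc hjc)
    (fun x _ x' _ h => clawS_pair_self hA h jc hjc1)
    (fun d x _ x' _ h => by
      have := clawVd_add_clawS_nonneg hA (h2 d.1 d.2) (by rw [union_comm]; exact h) jc hjc2; linarith)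
    (fun d d' hne x _ x' _ h => clawVd_add_clawVd_nonneg hA (h2 d.1 d.2) (h2 d'.1 d'.2)
      (hdis d.1 d.2 d'.1 d'.2 (fun e => hne (Subtype.ext e))) h)
    (fun x _ => clawS_val B x jc) (fun d x _ => by have := clawVd_bounds B d.1 x; omega)
    (fun x _ x' _ h => clawS_mono hB h jc) (fun d x _ x' _ h => clawVd_mono hB d.1 h)
    (fun d x _ => clawVd_le_clawS hB (h2 d.1 d.2) x jc hjc)
    (fun x _ x' _ h => clawS_pair_self hB h jc hjc1)
    (fun d x _ x' _ h => by
      have := clawVd_add_clawS_nonneg hB (h2 d.1 d.2) (by rw [union_comm]; exact h) jc hjc2; linarith)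
    (fun d d' hne x _ x' _ h => clawVd_add_clawVd_nonneg hB (h2 d.1 d.2) (h2 d'.1 d'.2)
      (hdis d.1 d.2 d'.1 d'.2 (fun e => hne (Subtype.ext e))) h)
  have hsub : ∀ x ∈ P₁, ∑ d : ↥E, clawVd A d.1 x * clawVd B d.1 x = ∑ d ∈ E, clawVd A d x * clawVd B d x :=
    fun x _ => Finset.sum_coe_sort E (fun d => clawVd A d x * clawVd B d x)
  rw [sum_congr rfl (fun x hx => by rw [hsub x hx]), sum_add_distrib] at key
  linarith

end mainthm

/-! ### Corollaries -/

variable {β : Type} [DecidableEq β] [Fintype β]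

/-- **`TriWIneq` for `P₁ ∧ clawMatching E`** (`#E ≥ 3`, `k ≥ 4`) on every index cube, for every intersecting Kleitman shell `P₁`. [this work] -/
theorem triW_nonneg_andProd_clawMatching (hk : 4 ≤ k) {E : Finset (Finset (Fin k))} (h2 : ∀ d ∈ E, d.card = 2)
    (hdis : ∀ d ∈ E, ∀ d' ∈ E, d ≠ d' → Disjoint d d') (hE : 3 ≤ E.card) {P₁ : Finset (Finset γ₁)}
    (hP : IsUpperSet (P₁ : Set (Finset γ₁))) (hd : Disjoint P₁ (refl P₁))
    (hcor : ∀ U V : Finset (Finset γ₁), IsUpperSet (U : Set (Finset γ₁)) → IsUpperSet (V : Set (Finset γ₁)) → 0 ≤ corP P₁ U V)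
    (F G : Finset β → Finset (Finset (γ₁ ⊕ Fin k)))
    (hF : ∀ x, IsUpperSet (F x : Set (Finset (γ₁ ⊕ Fin k)))) (hG : ∀ x, IsUpperSet (G x : Set (Finset (γ₁ ⊕ Fin k))))
    (hFm : Monotone F) (hGm : Monotone G) :
    0 ≤ triW (andProd P₁ (clawMatching E)) F G :=
  triW_nonneg_of_corP_nonneg (isUpperSet_andProd hP (isUpperSet_clawMatching h2))
    (fun _ _ hA hB => corP_andProd_clawMatching_nonneg hP hd hcor hA hB h2 hdis hk hE) F G hF hG hFm hGm

/-- **The AND-product is again an intersecting Kleitman shell.** [this work] -/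
theorem klShell_andProd_clawMatching (hk : 4 ≤ k) {E : Finset (Finset (Fin k))} (h2 : ∀ d ∈ E, d.card = 2)
    (hdis : ∀ d ∈ E, ∀ d' ∈ E, d ≠ d' → Disjoint d d') (hE : 3 ≤ E.card) {P₁ : Finset (Finset γ₁)}
    (hP : IsUpperSet (P₁ : Set (Finset γ₁))) (hd : Disjoint P₁ (refl P₁))
    (hcor : ∀ U V : Finset (Finset γ₁), IsUpperSet (U : Set (Finset γ₁)) → IsUpperSet (V : Set (Finset γ₁)) → 0 ≤ corP P₁ U V) :
    KlShell (andProd P₁ (clawMatching E) ∪ refl (andProd P₁ (clawMatching E))) :=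
  klShell_of_corP_nonneg (disjoint_andProd_refl hd _) fun _ _ hA hB => corP_andProd_clawMatching_nonneg hP hd hcor hA hB h2 hdis hk hE

/-- **`AndShellLower` for `Q = clawMatching E`** (`#E ≥ 3`, `k ≥ 5`). [this work] -/
theorem lForm_le_scoreVal_andProd_clawMatching (hk : 5 ≤ k) {E : Finset (Finset (Fin k))} (h2 : ∀ d ∈ E, d.card = 2)
    (hdis : ∀ d ∈ E, ∀ d' ∈ E, d ≠ d' → Disjoint d d') (hE : 3 ≤ E.card) {P₁ : Finset (Finset γ₁)}
    (hP : IsUpperSet (P₁ : Set (Finset γ₁))) (hd : Disjoint P₁ (refl P₁)) (hs : KlShell (P₁ ∪ refl P₁))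
    {A B : Finset (Finset (γ₁ ⊕ Fin k))} (hA : IsUpperSet (A : Set (Finset (γ₁ ⊕ Fin k)))) (hB : IsUpperSet (B : Set (Finset (γ₁ ⊕ Fin k)))) :
    lForm (andProd P₁ (clawMatching E)) A B ≤ scoreVal (secFAScore P₁ (clawMatching E)) A B :=
  lForm_le_scoreVal_secFAScore_of_corP_nonneg (disjoint_clawMatching_refl hk h2)
    (corP_andProd_clawMatching_nonneg hP hd (fun U V hU hV => by rw [corP_eq_card_sub_card_of_disjoint hd]; exact hs U V hU hV)
      hA hB h2 hdis (by omega) hE)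

/-- Example (`n = 6`, three doubled prongs): the block `maj3(x₀x₁, x₂x₃, x₄x₅)` is `clawMatching {{0,1},{2,3},{4,5}}`. [this work] -/
theorem clawMatching_maj3_pairs : clawMatching ({{0, 1}, {2, 3}, {4, 5}} : Finset (Finset (Fin 6)))
    = {{2, 3, 4, 5}, {0, 1, 4, 5}, {0, 1, 2, 3}, {1, 2, 3, 4, 5}, {0, 2, 3, 4, 5}, {0, 1, 3, 4, 5}, {0, 1, 2, 4, 5}, {0, 1, 2, 3, 5}, {0, 1, 2, 3, 4},
      {0, 1, 2, 3, 4, 5}} := by decide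

end FiveUpSet

end Summit.CriticalPhenomena.PercolationContinuityZ3.Theorems
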